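import Literature.NumberTheory.Automorphic.BrandtDefiniteSetupLiteOrder
import Literature.NumberTheory.Automorphic.BrandtSubidealSums
import HarnessLib

/-!
# Eichler's space `M_k(O)` of weight-`k` forms on a definite quaternion algebra and its Brandt
# operators, for the inline set-up `Brandt.DefiniteSetupLite` (Eichler 1973, Ch. II §6)

Topic `Literature/NumberTheory/Automorphic`; DEFINITIONS with bodies and their API (no named fact,
no instance; D-0026). For a definite set-up `S` of type `(N⁺, N⁻)` (`BrandtDefiniteSetupLite.lean`),
a splitting `ι : B → M₂(F)` and a weight `k`, the route items `VerticalContact` /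
`VerticalSelmerBound` and the named fact `jacquetLanglands_newform_of_brandtEigenformLite` speak of
functions `Φ` on the `ℤ`-lattices of `B = (a,b)_ℚ` with values in `F[X₀, X₁]` which, on the
invertible right `S.O`-ideals, are homogeneous of degree `k - 2`, `Bˣ`-equivariant for the
substitution action `ρ_β P (X) = P(X ι(β))` (`Brandt.coeffActionLite`), and eigenvectors of the sums
over the Hecke neighbours. These are the elements of Eichler's space of "automorphic forms of weight
`k`" on the definite algebra — LNM 320, Ch. II §6: the Brandt matrices `B_l(n)` with the
representation `R_l` of `Bˣ` on homogeneous forms of degree `l = k - 2` act on vectors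
`(P_i)_{i ∈ Cls O}`, `P_i ∈ F[X]_l` invariant under the units of the left order of `I_i`;
Dembélé–Voight 2013, §8, Def. before (8.1): `M_k^B(𝔑) = {f : B̂ˣ/Ôˣ → W_k : f(γ x) = γ f(x)}`, with
`T_𝔭` the sum over the `𝔭`-neighbours. This file DEFINES that space and those operators in the
representative-free form used by the items and proves the Hecke-algebra relations needed for the
trace argument of Eichler's basis problem:

* `Brandt.weightKFormsLite S ι k` — the `F`-subspace of functions `Φ : {ℤ-lattices of B} → F[X₀,X₁]`
  that are homogeneous of degree `k - 2` and `Bˣ`-equivariant on `rightIdealsLite S.O` and ZERO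
  off `rightIdealsLite S.O` (the values off the right ideals are irrelevant to the items; fixing them
  makes restriction to class representatives injective).
* `Brandt.heckeLite S F n` — **the Brandt operator `T(n)`** on all functions:
  `(T(n) Ψ)(I) = Σ_{M} Ψ(M)` over the invertible right `S.O`-ideals `M ⊆ I` of index `n²` (the
  tree's `Subideal (subringLattice S.O) I n`) for `I` an invertible right ideal, and `0` otherwise;
  `Brandt.heckeLite_mem` — it preserves `weightKFormsLite`; `Brandt.heckeLiteW S ι k n` — its
  restriction, an endomorphism of `weightKFormsLite S ι k`.
* Hecke relations on `weightKFormsLite` (Eichler 1973 II §6 Thm. 2; the lattice combinatorics is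
  `BrandtSubidealSums.lean`): `heckeLiteW_zero`, `heckeLiteW_one` (`T(1) = 1`),
  `heckeLiteW_mul_of_coprime` (**`T(mn) = T(m) T(n)`**, `(m, n) = 1`), `heckeLiteW_pow_succ_mul`
  (**`T(q^{a+1}) T(q) = T(q^{a+2}) + q·q^{k-2} T(q^a)`** for primes `q ∤ N⁺N⁻`: the central unit
  `q` acts on degree-`(k-2)` forms by `q^{k-2}`, `coeffActionLite_natCast_of_isHomogeneous`),
  `commute_heckeLiteW_pow` and `commute_heckeLiteW_of_prime` (the `T(q)`, `T(q^a)` commute),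
  `heckeLiteW_pow_add_two` (the recursion in the orientation `T(q^{a+2}) = T(q) T(q^{a+1}) - c T(q^a)`).
* `Brandt.finiteDimensional_weightKFormsLite` — `M_k(O) ⊗ F` is finite-dimensional (a form is
  determined by its values at representatives of the finite class set).
* `Brandt.indicator_mem_weightKFormsLite`, `Brandt.indicator_ne_zero`,
  `Brandt.heckeLite_indicator_of_prime` — a
  function `Φ` satisfying the items' clauses on the right ideals gives, after truncation off the
  right ideals, a non-zero element of `weightKFormsLite` on which `T(q)` (`q ∤ N⁺N⁻` prime) acts by
  the items' eigenvalue `lam q` (the Hecke neighbours of the items ARE the invertible sub-ideals of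
  index `q²`, `DefiniteSetupLite.mem_heckeNeighboursLite_iff`).

## References

* [Eichler1973] M. Eichler, LNM 320 (1973), Ch. II §6 (14)–(16) and Thm. 2 (17)–(19).
* [DembeleVoight2013] L. Dembélé, J. Voight, *Explicit methods for Hilbert modular forms* (2013),
  §8 (definite method: `M_k^B(𝔑)`, `T_𝔭`), Thm. 33.
* [Pizer1980] A. Pizer, J. Algebra 64 (1980), Prop. 2.22 (the `B(n)`, `(n, N) = 1`, commute).
-/

noncomputable section

open scoped Pointwise BigOperators

namespace Literature.NumberTheory.Automorphic

namespace Brandt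

/-! ### The substitution action of a central unit on homogeneous forms -/

/-- **Homogeneous polynomials are `c^d`-eigenvectors of `X ↦ c X`.** [folklore] -/
theorem aeval_smul_X_of_isHomogeneous {σ R : Type*} [CommRing R] {φ : MvPolynomial σ R} {d : ℕ}
    (hφ : φ.IsHomogeneous d) (c : R) :
    MvPolynomial.aeval (fun j => c • (MvPolynomial.X j : MvPolynomial σ R)) φ = c ^ d • φ := by
  classical
  conv_lhs => rw [φ.as_sum]
  conv_rhs => rw [φ.as_sum]
  rw [map_sum, Finset.smul_sum]
  refine Finset.sum_congr rfl fun s hs => ?_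
  have hdeg : d = ∑ i ∈ s.support, s i := hφ.degree_eq_sum_deg_support hs
  rw [MvPolynomial.aeval_monomial, MvPolynomial.algebraMap_eq, MvPolynomial.smul_eq_C_mul,
    MvPolynomial.monomial_eq, Finsupp.prod, Finsupp.prod]
  have hprod : (∏ i ∈ s.support, (c • (MvPolynomial.X i : MvPolynomial σ R)) ^ s i) =
      MvPolynomial.C (c ^ d) * ∏ i ∈ s.support, (MvPolynomial.X i : MvPolynomial σ R) ^ s i := by
    rw [hdeg, map_pow, ← Finset.prod_pow_eq_pow_sum, ← Finset.prod_mul_distrib]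
    refine Finset.prod_congr rfl fun i _ => ?_
    rw [MvPolynomial.smul_eq_C_mul, mul_pow]
  rw [hprod]
  ring

/-- **A central unit `u = q` acts on degree-`d` forms by `q^d`**: `coeffActionLite ι u P = q^d • P`
for `P` homogeneous of degree `d` (through any splitting `ι`, `ι(q) = q · 1`). [folklore] -/
theorem coeffActionLite_natCast_of_isHomogeneous {B F : Type*} [Ring B] [Field F] [Algebra ℚ B]
    [Algebra ℚ F] (ι : B →ₐ[ℚ] Matrix (Fin 2) (Fin 2) F) {q : ℕ} {u : Bˣ} (hu : (u : B) = q)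
    {P : MvPolynomial (Fin 2) F} {d : ℕ} (hP : P.IsHomogeneous d) :
    coeffActionLite ι u P = ((q : F) ^ d) • P := by
  have hι : ι (u : B) = (q : Matrix (Fin 2) (Fin 2) F) := by rw [hu, map_natCast]
  have hfun : (fun j : Fin 2 => ∑ i : Fin 2,
      MvPolynomial.X (R := F) i * MvPolynomial.C (ι (u : B) i j)) =
      fun j => (q : F) • (MvPolynomial.X j : MvPolynomial (Fin 2) F) := by
    funext j
    rw [hι]
    fin_cases j <;> simp [Matrix.natCast_apply, MvPolynomial.smul_eq_C_mul, mul_comm]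
  rw [coeffActionLite_def, hfun, aeval_smul_X_of_isHomogeneous hP]

variable {Nplus Nminus : ℕ} (S : DefiniteSetupLite Nplus Nminus)
variable (F : Type*) [Field F] [Algebra ℚ F]
variable (ι : QuaternionAlgebra ℚ S.a 0 S.b →ₐ[ℚ] Matrix (Fin 2) (Fin 2) F) (k : ℕ)

/-! ### Eichler's space of weight-`k` forms -/

/-- **Eichler's space `M_k(O) ⊗ F` of weight-`k` forms on the definite quaternion algebra of the
set-up `S`, representative-free form.** The `F`-subspace of the functions `Φ` on the `ℤ`-lattices of
`B = (a,b)_ℚ` with values in `F[X₀, X₁]` which (i) are homogeneous of degree `k - 2` on the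
invertible right `S.O`-ideals, (ii) are `Bˣ`-equivariant there for the substitution action
through `ι`, `Φ(βI) = ρ_β Φ(I)` (`Brandt.coeffActionLite`), and (iii) vanish off the invertible
right `S.O`-ideals. Restricting to representatives `I₁, …, I_h` of the right ideal classes
identifies it with `⊕_i (F[X]_{k-2})^{Γ_i}`, `Γ_i` the units of the left order of `I_i` —
Eichler's vectors on which the Brandt matrices `B_{k-2}(n)` act (LNM 320 II §6), Dembélé–Voight's
`M_k^B(𝔑)` for `F = ℚ` (2013, §8). [cite: Eichler1973, Ch. II §6] [cite: DembeleVoight2013, §8] -/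
def weightKFormsLite :
    Submodule F (Submodule ℤ (QuaternionAlgebra ℚ S.a 0 S.b) → MvPolynomial (Fin 2) F) where
  carrier := {Φ | (∀ I ∈ rightIdealsLite S.O, (Φ I).IsHomogeneous (k - 2)) ∧
    (∀ (β : (QuaternionAlgebra ℚ S.a 0 S.b)ˣ), ∀ I ∈ rightIdealsLite S.O,
      Φ (I.map (AddMonoidHom.mulLeft β.1).toIntLinearMap) = coeffActionLite ι β (Φ I)) ∧
    ∀ I, I ∉ rightIdealsLite S.O → Φ I = 0}
  zero_mem' := ⟨fun _ _ => MvPolynomial.isHomogeneous_zero _ _ _,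
    fun β I _ => by simp [coeffActionLite_def], fun _ _ => rfl⟩
  add_mem' {Φ Ψ} hΦ hΨ := ⟨fun I hI => (hΦ.1 I hI).add (hΨ.1 I hI),
    fun β I hI => by rw [Pi.add_apply, Pi.add_apply, hΦ.2.1 β I hI, hΨ.2.1 β I hI,
      coeffActionLite_def, coeffActionLite_def, coeffActionLite_def, map_add],
    fun I hI => by rw [Pi.add_apply, hΦ.2.2 I hI, hΨ.2.2 I hI, add_zero]⟩
  smul_mem' c Φ hΦ := ⟨fun I hI => by
      rw [Pi.smul_apply, MvPolynomial.smul_eq_C_mul]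
      simpa using (MvPolynomial.isHomogeneous_C _ c).mul (hΦ.1 I hI),
    fun β I hI => by rw [Pi.smul_apply, Pi.smul_apply, hΦ.2.1 β I hI,
      coeffActionLite_def, coeffActionLite_def, map_smul],
    fun I hI => by rw [Pi.smul_apply, hΦ.2.2 I hI, smul_zero]⟩

variable {S F ι k}

/-- Membership in `weightKFormsLite`: the three clauses. [folklore] -/
theorem mem_weightKFormsLite_iff
    {Φ : Submodule ℤ (QuaternionAlgebra ℚ S.a 0 S.b) → MvPolynomial (Fin 2) F} :
    Φ ∈ weightKFormsLite S F ι k ↔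
      (∀ I ∈ rightIdealsLite S.O, (Φ I).IsHomogeneous (k - 2)) ∧
      (∀ (β : (QuaternionAlgebra ℚ S.a 0 S.b)ˣ), ∀ I ∈ rightIdealsLite S.O,
        Φ (I.map (AddMonoidHom.mulLeft β.1).toIntLinearMap) = coeffActionLite ι β (Φ I)) ∧
      ∀ I, I ∉ rightIdealsLite S.O → Φ I = 0 :=
  Iff.rfl

/-- Equivariance in the tree's notation `β • I`. [folklore] -/
theorem apply_units_smul_of_mem
    {Φ : Submodule ℤ (QuaternionAlgebra ℚ S.a 0 S.b) → MvPolynomial (Fin 2) F}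
    (hΦ : Φ ∈ weightKFormsLite S F ι k) (β : (QuaternionAlgebra ℚ S.a 0 S.b)ˣ)
    {I : Submodule ℤ (QuaternionAlgebra ℚ S.a 0 S.b)} (hI : I ∈ rightIdealsLite S.O) :
    Φ (β • I) = coeffActionLite ι β (Φ I) := by
  rw [← map_mulLeft_eq_units_smul]
  exact hΦ.2.1 β I hI

/-! ### The Brandt operators -/

variable (S F)

open Classical in
/-- **The Brandt operator `T(n)` of the set-up `S`** on all functions from lattices to
`F[X₀, X₁]`: `(T(n) Ψ)(I) = Σ_M Ψ(M)` over the invertible right `S.O`-ideals `M ⊆ I` of index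
`[I : M] = n²` (the tree's `Subideal (subringLattice S.O) I n`; reduced norm `n · nrd I`) when `I`
is an invertible right `S.O`-ideal, and `0` otherwise. For `n = q` prime to `N⁺N⁻` the index set is
the items' `heckeNeighboursLite S.O q I` (`DefiniteSetupLite.mem_heckeNeighboursLite_iff`); on the
equivariant functions this is Eichler's Brandt matrix `B_{k-2}(n)` (LNM 320 II §6 (15)) and
Dembélé–Voight's `T_𝔭` (2013, §4 and §8). [cite: Eichler1973, Ch. II §6 (14)–(15)]
[cite: DembeleVoight2013, §8] -/
def heckeLite (n : ℕ) :
    Module.End F (Submodule ℤ (QuaternionAlgebra ℚ S.a 0 S.b) → MvPolynomial (Fin 2) F) where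
  toFun Ψ I := if IsInvertibleRightIdeal (subringLattice S.O) I then
      ∑ᶠ M : Subideal (subringLattice S.O) I n,
        Ψ ((M.1 : invertibleRightIdeals (subringLattice S.O)) :
          Submodule ℤ (QuaternionAlgebra ℚ S.a 0 S.b)) else 0
  map_add' Ψ₁ Ψ₂ := by
    funext I
    haveI : IsAddTorsionFree (QuaternionAlgebra ℚ S.a 0 S.b) :=
      isAddTorsionFree_of_charZero_module ℚ _
    simp only [Pi.add_apply]
    split_ifs with hI
    · haveI : Finite (Subideal (subringLattice S.O) I n) := Subideal.finite hI.isFullLattice.1 n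
      exact finsum_add_distrib (Set.toFinite _) (Set.toFinite _)
    · rw [add_zero]
  map_smul' c Ψ := by
    funext I
    haveI : IsAddTorsionFree (QuaternionAlgebra ℚ S.a 0 S.b) :=
      isAddTorsionFree_of_charZero_module ℚ _
    simp only [Pi.smul_apply, RingHom.id_apply]
    split_ifs with hI
    · haveI : Finite (Subideal (subringLattice S.O) I n) := Subideal.finite hI.isFullLattice.1 n
      exact (smul_finsum' c (Set.toFinite _)).symm
    · rw [smul_zero]

variable {S F}

open Classical in
omit [Algebra ℚ F] in
/-- `T(n) Ψ` evaluated (the defining case distinction). [folklore] -/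
theorem heckeLite_apply (n : ℕ)
    (Ψ : Submodule ℤ (QuaternionAlgebra ℚ S.a 0 S.b) → MvPolynomial (Fin 2) F)
    (I : Submodule ℤ (QuaternionAlgebra ℚ S.a 0 S.b)) :
    heckeLite S F n Ψ I = if IsInvertibleRightIdeal (subringLattice S.O) I then
      ∑ᶠ M : Subideal (subringLattice S.O) I n,
        Ψ ((M.1 : invertibleRightIdeals (subringLattice S.O)) :
          Submodule ℤ (QuaternionAlgebra ℚ S.a 0 S.b)) else 0 :=
  rfl

omit [Algebra ℚ F] in
/-- `T(n) Ψ` at an invertible right ideal: the sum over the sub-ideals of index `n²`. [folklore] -/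
theorem heckeLite_apply_of_isInvertibleRightIdeal (n : ℕ)
    (Ψ : Submodule ℤ (QuaternionAlgebra ℚ S.a 0 S.b) → MvPolynomial (Fin 2) F)
    {I : Submodule ℤ (QuaternionAlgebra ℚ S.a 0 S.b)}
    (hI : IsInvertibleRightIdeal (subringLattice S.O) I) :
    heckeLite S F n Ψ I = ∑ᶠ M : Subideal (subringLattice S.O) I n,
      Ψ ((M.1 : invertibleRightIdeals (subringLattice S.O)) :
        Submodule ℤ (QuaternionAlgebra ℚ S.a 0 S.b)) := by
  rw [heckeLite_apply, if_pos hI]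

omit [Algebra ℚ F] in
/-- `T(n) Ψ` vanishes off the invertible right ideals. [folklore] -/
theorem heckeLite_apply_of_not (n : ℕ)
    (Ψ : Submodule ℤ (QuaternionAlgebra ℚ S.a 0 S.b) → MvPolynomial (Fin 2) F)
    {I : Submodule ℤ (QuaternionAlgebra ℚ S.a 0 S.b)}
    (hI : ¬ IsInvertibleRightIdeal (subringLattice S.O) I) : heckeLite S F n Ψ I = 0 := by
  rw [heckeLite_apply, if_neg hI]

omit [Algebra ℚ F] in
/-- `T(n) Ψ` at `I ∈ rightIdealsLite S.O`, as a finite sum over any `Fintype` structure on the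
sub-ideals. [folklore] -/
theorem heckeLite_apply_eq_sum (n : ℕ)
    (Ψ : Submodule ℤ (QuaternionAlgebra ℚ S.a 0 S.b) → MvPolynomial (Fin 2) F)
    {I : Submodule ℤ (QuaternionAlgebra ℚ S.a 0 S.b)}
    (hI : IsInvertibleRightIdeal (subringLattice S.O) I) [Fintype (Subideal (subringLattice S.O) I n)] :
    heckeLite S F n Ψ I = ∑ M : Subideal (subringLattice S.O) I n,
      Ψ ((M.1 : invertibleRightIdeals (subringLattice S.O)) :
        Submodule ℤ (QuaternionAlgebra ℚ S.a 0 S.b)) := by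
  rw [heckeLite_apply_of_isInvertibleRightIdeal n Ψ hI, finsum_eq_sum_of_fintype]

/-- **`T(n)` preserves Eichler's space**: for `Φ ∈ weightKFormsLite`, `T(n) Φ` is again homogeneous
of degree `k - 2` (a sum of such), `Bˣ`-equivariant (`Sub(βI, n) = β Sub(I, n)`,
`finsum_subideal_units_smul`, and `ρ_β` is additive) and zero off the right ideals.
[cite: Eichler1973, Ch. II §6 (15)] -/
theorem heckeLite_mem (n : ℕ)
    {Φ : Submodule ℤ (QuaternionAlgebra ℚ S.a 0 S.b) → MvPolynomial (Fin 2) F}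
    (hΦ : Φ ∈ weightKFormsLite S F ι k) : heckeLite S F n Φ ∈ weightKFormsLite S F ι k := by
  haveI : IsAddTorsionFree (QuaternionAlgebra ℚ S.a 0 S.b) := isAddTorsionFree_of_charZero_module ℚ _
  refine ⟨fun I hI => ?_, fun β I hI => ?_, fun I hI => ?_⟩
  · -- homogeneity
    have hI' := (mem_rightIdealsLite_iff_isInvertibleRightIdeal S.O I).mp hI
    haveI : Finite (Subideal (subringLattice S.O) I n) := Subideal.finite hI'.isFullLattice.1 n
    letI : Fintype (Subideal (subringLattice S.O) I n) := Fintype.ofFinite _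
    rw [heckeLite_apply_eq_sum n Φ hI']
    exact MvPolynomial.IsHomogeneous.sum _ _ _ fun M _ =>
      hΦ.1 _ ((mem_rightIdealsLite_iff_isInvertibleRightIdeal S.O _).mpr M.isInvertibleRightIdeal)
  · -- equivariance
    have hI' := (mem_rightIdealsLite_iff_isInvertibleRightIdeal S.O I).mp hI
    have hβI : IsInvertibleRightIdeal (subringLattice S.O) (β • I) := hI'.units_smul β
    haveI : Finite (Subideal (subringLattice S.O) I n) := Subideal.finite hI'.isFullLattice.1 n
    letI : Fintype (Subideal (subringLattice S.O) I n) := Fintype.ofFinite _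
    rw [map_mulLeft_eq_units_smul, heckeLite_apply_of_isInvertibleRightIdeal n Φ hβI,
      finsum_subideal_units_smul β I n Φ, finsum_eq_sum_of_fintype, heckeLite_apply_eq_sum n Φ hI',
      coeffActionLite_def, map_sum]
    refine Finset.sum_congr rfl fun M _ => ?_
    rw [← coeffActionLite_def]
    exact apply_units_smul_of_mem hΦ β
      ((mem_rightIdealsLite_iff_isInvertibleRightIdeal S.O _).mpr M.isInvertibleRightIdeal)
  · -- zero off the right ideals
    exact heckeLite_apply_of_not n Φ
      (fun h => hI ((mem_rightIdealsLite_iff_isInvertibleRightIdeal S.O I).mpr h))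

variable (S F ι k)

/-- **The Brandt operator `T(n)` on Eichler's space** `weightKFormsLite S F ι k` (the restriction
of `heckeLite`). [cite: Eichler1973, Ch. II §6 (15)] -/
def heckeLiteW (n : ℕ) : Module.End F (weightKFormsLite S F ι k) :=
  (heckeLite S F n).restrict fun _ hΦ => heckeLite_mem n hΦ

variable {S F ι k}

/-- The restricted operator, evaluated. [folklore] -/
@[simp] theorem coe_heckeLiteW_apply (n : ℕ) (Φ : weightKFormsLite S F ι k) :
    ((heckeLiteW S F ι k n Φ : weightKFormsLite S F ι k) :
      Submodule ℤ (QuaternionAlgebra ℚ S.a 0 S.b) → MvPolynomial (Fin 2) F) = heckeLite S F n Φ :=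
  rfl

/-! ### The Hecke relations on Eichler's space -/

/-- `T(0) = 0` (there are no sub-ideals of index `0`, i.e. of infinite index, in a full lattice).
[folklore] -/
theorem heckeLiteW_zero : heckeLiteW S F ι k 0 = 0 := by
  haveI : IsAddTorsionFree (QuaternionAlgebra ℚ S.a 0 S.b) := isAddTorsionFree_of_charZero_module ℚ _
  apply LinearMap.ext; intro Φ; apply Subtype.ext; funext I
  change heckeLite S F 0 Φ I = 0
  by_cases hI : IsInvertibleRightIdeal (subringLattice S.O) I
  · haveI := Subideal.isEmpty_zero (O := subringLattice S.O) (I := I) hI.isFullLattice.1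
    rw [heckeLite_apply_of_isInvertibleRightIdeal 0 _ hI, finsum_of_isEmpty]
  · exact heckeLite_apply_of_not 0 _ hI

/-- **`T(1) = 1`** on Eichler's space (`Sub(I, 1) = {I}`; off the right ideals both sides vanish).
[cite: Eichler1973, Ch. II §6 Thm. 2] -/
theorem heckeLiteW_one : heckeLiteW S F ι k 1 = 1 := by
  apply LinearMap.ext; intro Φ; apply Subtype.ext; funext I
  change heckeLite S F 1 Φ I = Φ.1 I
  by_cases hI : IsInvertibleRightIdeal (subringLattice S.O) I
  · rw [heckeLite_apply_of_isInvertibleRightIdeal 1 _ hI, finsum_subideal_one hI]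
  · rw [heckeLite_apply_of_not 1 _ hI,
      Φ.2.2.2 I (fun h => hI ((mem_rightIdealsLite_iff_isInvertibleRightIdeal S.O I).mp h))]

/-- **`T(mn) = T(m) T(n)` for coprime `m, n ≥ 1`** (Eichler 1973 II §6 Thm. 2 (18): unique
factorisation of a sub-ideal of index `(mn)²` through the intermediate ideal of index `m²`,
`finsum_subideal_finsum_subideal_of_coprime`). [cite: Eichler1973, Ch. II §6 Thm. 2 (18)] -/
theorem heckeLiteW_mul_of_coprime {m n : ℕ} (hm : m ≠ 0) (hn : n ≠ 0) (hmn : m.Coprime n) :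
    heckeLiteW S F ι k (m * n) = heckeLiteW S F ι k m * heckeLiteW S F ι k n := by
  haveI : IsAddTorsionFree (QuaternionAlgebra ℚ S.a 0 S.b) := isAddTorsionFree_of_charZero_module ℚ _
  apply LinearMap.ext; intro Φ; apply Subtype.ext; funext I
  change heckeLite S F (m * n) Φ I = heckeLite S F m (heckeLite S F n Φ) I
  by_cases hI : IsInvertibleRightIdeal (subringLattice S.O) I
  · rw [heckeLite_apply_of_isInvertibleRightIdeal (m * n) _ hI,
      heckeLite_apply_of_isInvertibleRightIdeal m _ hI,
      ← finsum_subideal_finsum_subideal_of_coprime hI hm hn hmn]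
    refine finsum_congr fun J => ?_
    rw [heckeLite_apply_of_isInvertibleRightIdeal n _ J.isInvertibleRightIdeal]
  · rw [heckeLite_apply_of_not _ _ hI, heckeLite_apply_of_not _ _ hI]

/-- `T(mn) = T(m) T(n)` for coprime `m, n` without positivity hypotheses (with `T(0) = 0` the
degenerate cases are `0 = 0` or trivial). [folklore] -/
theorem heckeLiteW_mul_of_coprime' {m n : ℕ} (hmn : m.Coprime n) :
    heckeLiteW S F ι k (m * n) = heckeLiteW S F ι k m * heckeLiteW S F ι k n := by
  rcases Nat.eq_zero_or_pos m with rfl | hm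
  · have hn1 : n = 1 := by simpa [Nat.coprime_zero_left] using hmn
    rw [hn1, mul_one, heckeLiteW_one, mul_one]
  rcases Nat.eq_zero_or_pos n with rfl | hn
  · have hm1 : m = 1 := by simpa [Nat.coprime_zero_right] using hmn
    rw [hm1, one_mul, heckeLiteW_one, one_mul]
  exact heckeLiteW_mul_of_coprime hm.ne' hn.ne' hmn

/-- The `T(m)`, `T(n)` for coprime `m, n` commute (both products are `T(mn)`). [cite: Pizer1980, Prop. 2.22] -/
theorem commute_heckeLiteW_of_coprime {m n : ℕ} (hmn : m.Coprime n) :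
    Commute (heckeLiteW S F ι k m) (heckeLiteW S F ι k n) := by
  change heckeLiteW S F ι k m * heckeLiteW S F ι k n = heckeLiteW S F ι k n * heckeLiteW S F ι k m
  rw [← heckeLiteW_mul_of_coprime' hmn, ← heckeLiteW_mul_of_coprime' hmn.symm, mul_comm]

/-- **`T(q^{a+1}) T(q) = T(q^{a+2}) + q · q^{k-2} T(q^a)` for a prime `q ∤ N⁺N⁻`** on Eichler's
space (Eichler 1973 II §6 Thm. 2 (19) with the representation `R_{k-2}`: the lattice recursion
`finsum_subideal_finsum_subideal_prime` at the residually split prime `q`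
(`DefiniteSetupLite.isResiduallySplit`), and `Φ(q K') = ρ_q Φ(K') = q^{k-2} Φ(K')` for the central
unit `q`, `coeffActionLite_natCast_of_isHomogeneous`). [cite: Eichler1973, Ch. II §6 Thm. 2 (19)] -/
theorem heckeLiteW_pow_succ_mul {q : ℕ} (hq : q.Prime) (hqN : ¬ q ∣ Nplus * Nminus) (a : ℕ) :
    heckeLiteW S F ι k (q ^ (a + 1)) * heckeLiteW S F ι k q =
      heckeLiteW S F ι k (q ^ (a + 2)) + ((q : F) * (q : F) ^ (k - 2)) • heckeLiteW S F ι k (q ^ a) := by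
  haveI : IsAddTorsionFree (QuaternionAlgebra ℚ S.a 0 S.b) := isAddTorsionFree_of_charZero_module ℚ _
  haveI : IsQuaternionAlgebra ℚ (QuaternionAlgebra ℚ S.a 0 S.b) := S.isQuaternionAlgebra
  obtain ⟨u, hu⟩ := exists_units_eq_natCast (B := QuaternionAlgebra ℚ S.a 0 S.b) hq.ne_zero
  apply LinearMap.ext; intro Φ; apply Subtype.ext; funext I
  change heckeLite S F (q ^ (a + 1)) (heckeLite S F q Φ) I =
    heckeLite S F (q ^ (a + 2)) Φ I + ((q : F) * (q : F) ^ (k - 2)) • heckeLite S F (q ^ a) Φ I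
  by_cases hI : IsInvertibleRightIdeal (subringLattice S.O) I
  · rw [heckeLite_apply_of_isInvertibleRightIdeal _ _ hI,
      heckeLite_apply_of_isInvertibleRightIdeal _ _ hI,
      heckeLite_apply_of_isInvertibleRightIdeal _ _ hI]
    have hinner : (∑ᶠ J : Subideal (subringLattice S.O) I (q ^ (a + 1)),
        heckeLite S F q Φ ((J.1 : invertibleRightIdeals (subringLattice S.O)) : Submodule ℤ _)) =
        ∑ᶠ J : Subideal (subringLattice S.O) I (q ^ (a + 1)),
          ∑ᶠ K : Subideal (subringLattice S.O)
            ((J.1 : invertibleRightIdeals (subringLattice S.O)) : Submodule ℤ _) q,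
            Φ.1 ((K.1 : invertibleRightIdeals (subringLattice S.O)) : Submodule ℤ _) :=
      finsum_congr fun J => heckeLite_apply_of_isInvertibleRightIdeal q _ J.isInvertibleRightIdeal
    rw [hinner, finsum_subideal_finsum_subideal_prime S.forall_isUnit S.isZOrder hq
      (S.isResiduallySplit hq hqN) hI a hu Φ.1, pow_succ]
    congr 1
    -- the central unit `q` acts by `q^{k-2}`
    haveI : Finite (Subideal (subringLattice S.O) I (q ^ a)) := Subideal.finite hI.isFullLattice.1 _
    letI : Fintype (Subideal (subringLattice S.O) I (q ^ a)) := Fintype.ofFinite _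
    rw [finsum_eq_sum_of_fintype, finsum_eq_sum_of_fintype, Finset.smul_sum, Finset.smul_sum]
    refine Finset.sum_congr rfl fun K' _ => ?_
    have hK' : ((K'.1 : invertibleRightIdeals (subringLattice S.O)) : Submodule ℤ _) ∈ rightIdealsLite S.O :=
      (mem_rightIdealsLite_iff_isInvertibleRightIdeal S.O _).mpr K'.isInvertibleRightIdeal
    rw [apply_units_smul_of_mem Φ.2 u hK', coeffActionLite_natCast_of_isHomogeneous ι hu (Φ.2.1 _ hK'),
      ← Nat.cast_smul_eq_nsmul F q, smul_smul]
  · rw [heckeLite_apply_of_not _ _ hI, heckeLite_apply_of_not _ _ hI, heckeLite_apply_of_not _ _ hI,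
      smul_zero, add_zero]

/-- The `T(q^a)` for a prime `q ∤ N⁺N⁻` pairwise commute (each is a polynomial in `T(q)`: the
three-term recursion, `commute_of_recursion`). [cite: Pizer1980, Prop. 2.22] -/
theorem commute_heckeLiteW_pow {q : ℕ} (hq : q.Prime) (hqN : ¬ q ∣ Nplus * Nminus) (a b : ℕ) :
    Commute (heckeLiteW S F ι k (q ^ a)) (heckeLiteW S F ι k (q ^ b)) := by
  refine commute_of_recursion (fun a => heckeLiteW S F ι k (q ^ a))
    (((q : F) * (q : F) ^ (k - 2)) • 1) (fun a => (Commute.one_left _).smul_left _)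
    (by rw [pow_zero, heckeLiteW_one]) (fun a => ?_) a b
  have h := heckeLiteW_pow_succ_mul (S := S) (F := F) (ι := ι) (k := k) hq hqN a
  rw [pow_one, h, smul_mul_assoc, one_mul]
  abel

/-- **The recursion in the Hecke-family orientation**: for a prime `q ∤ N⁺N⁻`,
`T(q^{a+2}) = T(q) T(q^{a+1}) - q·q^{k-2} T(q^a)` on Eichler's space. [cite: Eichler1973, Ch. II §6 Thm. 2 (19)] -/
theorem heckeLiteW_pow_add_two {q : ℕ} (hq : q.Prime) (hqN : ¬ q ∣ Nplus * Nminus) (a : ℕ) :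
    heckeLiteW S F ι k (q ^ (a + 2)) =
      heckeLiteW S F ι k q * heckeLiteW S F ι k (q ^ (a + 1)) -
        ((q : F) * (q : F) ^ (k - 2)) • heckeLiteW S F ι k (q ^ a) := by
  have hcomm := commute_heckeLiteW_pow (S := S) (F := F) (ι := ι) (k := k) hq hqN 1 (a + 1)
  rw [pow_one] at hcomm
  rw [hcomm.eq, heckeLiteW_pow_succ_mul hq hqN a]
  abel

/-- **The `T(q)`, `T(q')` for primes `q, q' ∤ N⁺N⁻` commute.** [cite: Pizer1980, Prop. 2.22] -/
theorem commute_heckeLiteW_of_prime {q q' : ℕ} (hq : q.Prime) (hq' : q'.Prime) :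
    Commute (heckeLiteW S F ι k q) (heckeLiteW S F ι k q') := by
  by_cases hqq : q = q'
  · subst hqq
    exact Commute.refl _
  · exact commute_heckeLiteW_of_coprime ((Nat.coprime_primes hq hq').mpr hqq)

/-! ### Finite dimension -/

/-- **Eichler's space is finite-dimensional**: a form is determined by its values at
representatives of the (finitely many, `DefiniteSetupLite.finite_rightIdealClass`) right ideal
classes (`Φ(βI) = ρ_β Φ(I)`), and those values have total degree `≤ k - 2`. [cite: Eichler1973, Ch. II §6] -/
theorem finiteDimensional_weightKFormsLite : FiniteDimensional F (weightKFormsLite S F ι k) := by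
  classical
  haveI := S.finite_rightIdealClass
  letI : Fintype (RightIdealClass (subringLattice S.O)) := Fintype.ofFinite _
  -- evaluation at the chosen representatives
  let e : weightKFormsLite S F ι k →ₗ[F]
      (RightIdealClass (subringLattice S.O) → MvPolynomial.restrictTotalDegree (Fin 2) F (k - 2)) :=
    { toFun := fun Φ i => ⟨Φ.1 (RightIdealClass.rep i), by
        rw [MvPolynomial.mem_restrictTotalDegree]
        exact (Φ.2.1 _ ((mem_rightIdealsLite_iff_isInvertibleRightIdeal S.O _).mpr
          (RightIdealClass.isInvertibleRightIdeal_rep i))).totalDegree_le⟩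
      map_add' := fun Φ Ψ => by funext i; rfl
      map_smul' := fun c Φ => by funext i; rfl }
  refine Module.Finite.of_injective e fun Φ Ψ h => ?_
  -- a form vanishing at the representatives vanishes
  rw [← sub_eq_zero] at h ⊢
  rw [← map_sub] at h
  set Θ := Φ - Ψ with hΘ
  apply Subtype.ext; funext I
  change Θ.1 I = 0
  by_cases hI : I ∈ rightIdealsLite S.O
  · have hI' := (mem_rightIdealsLite_iff_isInvertibleRightIdeal S.O I).mp hI
    set i : RightIdealClass (subringLattice S.O) := RightIdealClass.mk ⟨I, hI'⟩ with hi
    have hrep : Θ.1 (RightIdealClass.rep i) = 0 := by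
      have := congrArg (fun f => (f i : MvPolynomial (Fin 2) F)) h
      exact this
    obtain ⟨β, hβ⟩ : ∃ β : (QuaternionAlgebra ℚ S.a 0 S.b)ˣ,
        I = β • RightIdealClass.rep i := by
      have hmk : RightIdealClass.mk ⟨RightIdealClass.rep i, RightIdealClass.isInvertibleRightIdeal_rep i⟩ =
          RightIdealClass.mk ⟨I, hI'⟩ := by rw [RightIdealClass.mk_rep]
      exact RightIdealClass.mk_eq_mk_iff.mp hmk
    rw [hβ, apply_units_smul_of_mem Θ.2 β ((mem_rightIdealsLite_iff_isInvertibleRightIdeal S.O _).mpr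
      (RightIdealClass.isInvertibleRightIdeal_rep i)), hrep, coeffActionLite_def, map_zero]
  · exact Θ.2.2.2 I hI

/-! ### From the items' `Φ` to an eigenvector in Eichler's space -/

/-- **Truncation off the right ideals**: a function `Φ` which on `rightIdealsLite S.O` is
homogeneous of degree `k - 2` and `Bˣ`-equivariant becomes, after being set to `0` off the right
ideals (`Set.indicator`), an element of `weightKFormsLite`. [folklore] -/
theorem indicator_mem_weightKFormsLite
    {Φ : Submodule ℤ (QuaternionAlgebra ℚ S.a 0 S.b) → MvPolynomial (Fin 2) F}
    (hhom : ∀ I ∈ rightIdealsLite S.O, (Φ I).IsHomogeneous (k - 2))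
    (hequiv : ∀ (β : (QuaternionAlgebra ℚ S.a 0 S.b)ˣ), ∀ I ∈ rightIdealsLite S.O,
      Φ (I.map (AddMonoidHom.mulLeft β.1).toIntLinearMap) = coeffActionLite ι β (Φ I)) :
    (rightIdealsLite S.O).indicator Φ ∈ weightKFormsLite S F ι k := by
  refine ⟨fun I hI => ?_, fun β I hI => ?_, fun I hI => Set.indicator_of_notMem hI Φ⟩
  · rw [Set.indicator_of_mem hI]
    exact hhom I hI
  · have hβI : I.map (AddMonoidHom.mulLeft β.1).toIntLinearMap ∈ rightIdealsLite S.O := by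
      rw [map_mulLeft_eq_units_smul, mem_rightIdealsLite_iff_isInvertibleRightIdeal]
      exact ((mem_rightIdealsLite_iff_isInvertibleRightIdeal S.O I).mp hI).units_smul β
    rw [Set.indicator_of_mem hI, Set.indicator_of_mem hβI]
    exact hequiv β I hI

omit [Algebra ℚ F] in
/-- The truncation is non-zero as soon as `Φ` is non-zero at some right ideal. [folklore] -/
theorem indicator_ne_zero {Φ : Submodule ℤ (QuaternionAlgebra ℚ S.a 0 S.b) → MvPolynomial (Fin 2) F}
    (hne : ∃ I ∈ rightIdealsLite S.O, Φ I ≠ 0) : (rightIdealsLite S.O).indicator Φ ≠ 0 := by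
  obtain ⟨I, hI, hΦ⟩ := hne
  intro h
  have := congrFun h I
  rw [Set.indicator_of_mem hI, Pi.zero_apply] at this
  exact hΦ this

omit [Algebra ℚ F] in
/-- **The Brandt operator at a good prime on the truncation is the items' neighbour sum**: for a
prime `q ∤ N⁺N⁻`, if `Σ_{J ∈ heckeNeighboursLite S.O q I} Φ(J) = lam q • Φ(I)` for all right ideals
`I`, then `T(q)` acts on the truncation of `Φ` by `lam q` (the Hecke neighbours are exactly the
invertible sub-ideals of index `q²`, `DefiniteSetupLite.mem_heckeNeighboursLite_iff`).
[cite: DembeleVoight2013, §8] [cite: Eichler1973, Ch. II §6 (15)] -/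
theorem heckeLite_indicator_of_prime {q : ℕ} (hq : q.Prime) (hqN : ¬ q ∣ Nplus * Nminus)
    {lamq : F} {Φ : Submodule ℤ (QuaternionAlgebra ℚ S.a 0 S.b) → MvPolynomial (Fin 2) F}
    (hhecke : ∀ I ∈ rightIdealsLite S.O, ∑ᶠ J ∈ heckeNeighboursLite S.O q I, Φ J = lamq • Φ I) :
    heckeLite S F q ((rightIdealsLite S.O).indicator Φ) = lamq • (rightIdealsLite S.O).indicator Φ := by
  funext I
  rw [Pi.smul_apply]
  by_cases hI : I ∈ rightIdealsLite S.O
  · have hI' := (mem_rightIdealsLite_iff_isInvertibleRightIdeal S.O I).mp hI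
    rw [heckeLite_apply_of_isInvertibleRightIdeal q _ hI', Set.indicator_of_mem hI, ← hhecke I hI]
    -- the sum over `Sub(I, q)` is the sum over the Hecke neighbours
    have hmem : ∀ M : Subideal (subringLattice S.O) I q,
        ((M.1 : invertibleRightIdeals (subringLattice S.O)) : Submodule ℤ _) ∈ rightIdealsLite S.O :=
      fun M => (mem_rightIdealsLite_iff_isInvertibleRightIdeal S.O _).mpr M.isInvertibleRightIdeal
    have h1 : (∑ᶠ M : Subideal (subringLattice S.O) I q,
        (rightIdealsLite S.O).indicator Φ
          ((M.1 : invertibleRightIdeals (subringLattice S.O)) : Submodule ℤ _)) =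
        ∑ᶠ M : Subideal (subringLattice S.O) I q,
          Φ ((M.1 : invertibleRightIdeals (subringLattice S.O)) : Submodule ℤ _) :=
      finsum_congr fun M => Set.indicator_of_mem (hmem M) Φ
    rw [h1, ← finsum_set_coe_eq_finsum_mem]
    -- bijection `Sub(I, q) → heckeNeighboursLite S.O q I`
    have hmem2 : ∀ M : Subideal (subringLattice S.O) I q,
        ((M.1 : invertibleRightIdeals (subringLattice S.O)) : Submodule ℤ (QuaternionAlgebra ℚ S.a 0 S.b)) ∈
          heckeNeighboursLite S.O q I := fun M =>
      (S.mem_heckeNeighboursLite_iff hq hqN hI _).mpr ⟨hmem M, M.le, M.relIndex_eq⟩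
    let f : Subideal (subringLattice S.O) I q → ↥(heckeNeighboursLite S.O q I) := fun M =>
      ⟨((M.1 : invertibleRightIdeals (subringLattice S.O)) : Submodule ℤ (QuaternionAlgebra ℚ S.a 0 S.b)),
        hmem2 M⟩
    have hf : ∀ M : Subideal (subringLattice S.O) I q,
        ((f M : ↥(heckeNeighboursLite S.O q I)) : Submodule ℤ (QuaternionAlgebra ℚ S.a 0 S.b)) =
          ((M.1 : invertibleRightIdeals (subringLattice S.O)) : Submodule ℤ _) := fun M => rfl
    have hinj : Function.Injective f := fun M M' h =>
      Subideal.ext (by rw [← hf M, ← hf M', h])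
    have hsurj : Function.Surjective f := fun J => by
      obtain ⟨hJ, hJI, hidx⟩ := (S.mem_heckeNeighboursLite_iff hq hqN hI J.1).mp J.2
      exact ⟨⟨⟨J.1, (mem_rightIdealsLite_iff_isInvertibleRightIdeal S.O _).mp hJ⟩, hJI, hidx⟩,
        Subtype.ext rfl⟩
    exact finsum_eq_of_bijective f ⟨hinj, hsurj⟩ fun M => by rw [hf M]
  · rw [heckeLite_apply_of_not q _
      (fun h => hI ((mem_rightIdealsLite_iff_isInvertibleRightIdeal S.O I).mpr h)),
      Set.indicator_of_notMem hI, smul_zero]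

end Brandt

end Literature.NumberTheory.Automorphic

end
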